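import Mathlib
import Summits.KontsevichZagierPeriods.Zeta5Search.SecondOrderPair
import Summits.KontsevichZagierPeriods.Zeta5Search.SecondOrderCentre
import Summits.KontsevichZagierPeriods.Zeta5Search.SecondOrderCorr
import HarnessLib

/-!
# ζ(5) search — the DEEP PAIRS and the SUB-DEEP ORBITS of THEOREM A‴ (`LawA3`): every orbit vector is a multiple of `τ(T)`

Cell `pub-zeta5` (HONEST FRAMING: systematic search; no irrationality claim unless certified), typer seat generation 11.
REPORT-gen2-g10 §2–§3 in the tree's language, for the hypotheses of `SecondOrder.LawA3` (one palindromic deep type `T`, sub-deep classes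
single raises of `T` or the odd-centre class of type `T`).  With `(L_T, e_T)` the exponent function of the LIST `T` (`tList`, so that the
direction `τ(T) = (typeTauW, typeTauV)` is a function of `T` alone, common to `b` and `b + e_j`):
* `deep_data` — a deep class (`E_x = −M`, multipole, type list `T`) has `ŵ_x = 0`, `2ŵ₂_x = τ_W(T)`, `2v̂₂_x − L_x v̂_x = τ_V(T)`,
  `v̂_x̄ = v̂_x`;
* `live_pair` — a LIVE sub-deep class `y` (`ν_y = E_y = −M+1`) has `ŵ_y + ŵ_ȳ = τ_W(T)` and `v̂_y + v̂_ȳ = τ_V(T)` (raise lemma +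
  vanishing translation term, or the odd-centre class; an odd-centre class is never a raise: `even_of_pal_raise` vs `odd_L_of_centre`);
(the consequence for the pairs `ĝ_yσ_y + ĝ_ȳσ_ȳ`, `sub_pair_norm`, is in the sequel file `SecondOrderAggregate`).
Nothing here bears on irrationality.
-/

noncomputable section

open Finset PowerSeries

namespace Summit.KontsevichZagierPeriods.Zeta5Search.SecondOrder

open Summit.KontsevichZagierPeriods.Zeta5Search.DualSeries (InBox)
open Summit.KontsevichZagierPeriods.Zeta5Search.CasoratianValuation (InPolytope)
open Summit.KontsevichZagierPeriods.Zeta5Search.ClusterValuation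
open Summit.KontsevichZagierPeriods.Zeta5Search.PadicSeries
open Summit.KontsevichZagierPeriods.Zeta5Search.LevelClass (typeRho typeW typeV typeExp classSet_level level_injective level_mem
  classPoles_level typeW_congr typeV_congr)
open Summit.KontsevichZagierPeriods.Zeta5Search.CellKit (conj_level netExp_conj_level conjClass_eq_level)
open Literature.NumberTheory.Transcendental.BallRivoal (harm)

variable {p : ℕ} [hp : Fact p.Prime]

/-! ## §1 The exponent function of the list `T` -/

/-- The exponent function of a type LIST. -/
def tList (T : List ℤ) : ℕ → ℤ := fun k => T.getD k 0

/-- The top level of a type list. -/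
def tTop (T : List ℤ) : ℕ := T.length - 1

omit hp in
/-- A level list determines the `getD` data. -/
theorem tList_of_range_map {L : ℕ} {f : ℕ → ℤ} {T : List ℤ} (h : (List.range (L + 1)).map f = T) :
    tTop T = L ∧ ∀ k ≤ L, tList T k = f k := by
  subst h
  refine ⟨by simp [tTop], fun k hk => ?_⟩
  simp [tList, List.getD_eq_getElem?_getD, hk]

omit hp in
/-- A non-empty list is the level list of its `getD` data. -/
theorem range_map_tList {T : List ℤ} (hT : T ≠ []) : (List.range (tTop T + 1)).map (tList T) = T := by
  have hlen : T.length - 1 + 1 = T.length := by have := List.length_pos_iff.2 hT; omega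
  symm
  apply List.ext_getElem
  · simp [tTop, hlen]
  · intro i h1 h2
    simp [tList, List.getD_eq_getElem?_getD, h1]

omit hp in
/-- A palindromic list has palindromic `getD` data. -/
theorem tList_pal {T : List ℤ} (hT : T.reverse = T) : ∀ k ≤ tTop T, tList T (tTop T - k) = tList T k := by
  intro k hk
  by_cases hT0 : T = []
  · subst hT0; simp [tList]
  have hlen : 0 < T.length := List.length_pos_iff.2 hT0
  have hk' : k < T.length := by unfold tTop at hk; omega
  have h := congrArg (fun l => l.getD k 0) hT
  simp only [List.getD_eq_getElem?_getD, List.getElem?_reverse hk'] at h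
  simp only [tList, tTop, List.getD_eq_getElem?_getD]
  exact h

/-! ## §2 Level data of a class from the hypotheses of `LawA3` -/

section Spec

variable (b : ℕ → ℤ) {x : ℕ} (hx : x < p) (hxn : x ≤ (b 0).toNat)
include hx hxn

omit hx in
/-- The level bounds of the class of `x ≤ b₀`. -/
theorem level_bounds' : x + topLevel b p x * p ≤ (b 0).toNat ∧ (b 0).toNat < x + topLevel b p x * p + p :=
  level_bounds b hp.out.pos hxn

omit hx in
/-- **A class with type list `T` carries the exponents `tList T` on the levels `0..tTop T = topLevel`.** -/
theorem spec_of_typeList {T : List ℤ} (h : classTypeList b p x = T) :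
    tTop T = topLevel b p x ∧ ∀ k ≤ topLevel b p x, netExp b (x + k * p) = tList T k := by
  obtain ⟨hL, hL'⟩ := level_bounds' (p := p) b hxn
  rw [classTypeList_level b hL hL'] at h
  obtain ⟨h1, h2⟩ := tList_of_range_map h
  exact ⟨h1, fun k hk => (h2 k hk).symm⟩

end Spec

/-! ## §3 Deep classes -/

omit hp in
/-- `x ≤ b₀` for a residue `x < p ≤ b₀`. -/
theorem le_b0_of_lt (b : ℕ → ℤ) {x : ℕ} (hpn : (p : ℤ) ≤ b 0) (hx : x < p) : x ≤ (b 0).toNat := by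
  have h1 : (x : ℤ) < p := by exact_mod_cast hx
  have h2 : (x : ℤ) ≤ b 0 := by linarith
  omega

section Deep

variable (b : ℕ → ℤ) (hb : InPolytope b) (hpn : (p : ℤ) ≤ b 0)
  {T : List ℤ} (hT : T.reverse = T) {x : ℕ} (hx : x < p) (hc : ¬ CentreIn b p x) (htl : classTypeList b p x = T)
include hb hpn hT hx hc htl

/-- **Deep-class data.**  `ŵ_x = 0` (for `3 + E_x` odd), `τ_W(x) = τ_W(T)`, `τ_V(x) = τ_V(T)`, and `v̂_x̄ = v̂_x`. -/
theorem deep_data (hodd : Odd (3 + classExp b p x)) :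
    wHat b p x = 0 ∧ tauW b p x = typeTauW (tTop T) (tList T) ∧ tauV b p x = typeTauV (tTop T) (tList T) ∧
      vHat b p (conjClass b p x) = vHat b p x := by
  have h0 : 0 ≤ b 0 := hb.1.1
  have hxn := le_b0_of_lt b hpn hx
  obtain ⟨hL, hL'⟩ := level_bounds' (p := p) b hxn
  obtain ⟨htop, he⟩ := spec_of_typeList b hxn htl
  set L := topLevel b p x with hLdef
  have hpal : ∀ k ≤ L, netExp b (x + (L - k) * p) = netExp b (x + k * p) := by
    intro k hk
    rw [he k hk, he (L - k) (by omega), ← htop]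
    exact tList_pal hT k (by omega)
  have hc0 : ¬ (¬ (2 : ℤ) ∣ b 0 ∧ CentreIn b p x) := fun h => hc h.2
  refine ⟨?_, ?_, ?_, ?_⟩
  · -- `ŵ_x = 0` by the palindrome involution
    have hpal' : ∀ s ∈ classSet b p x, netExp b s = netExp b ((b 0).toNat - ((b 0).toNat - x) % p - (s - x)) := by
      intro s hs
      rw [classSet_level b hx hL hL'] at hs
      obtain ⟨k, hk, rfl⟩ := mem_image.1 hs
      have hkL : k ≤ L := by have := mem_range.1 hk; omega
      have hmod : ((b 0).toNat - x) % p = (b 0).toNat - x - L * p := by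
        have h1 := Nat.div_add_mod ((b 0).toNat - x) p
        have h2 : ((b 0).toNat - x) / p = L := rfl
        rw [h2] at h1
        have : p * L = L * p := mul_comm _ _
        omega
      have e1 : (b 0).toNat - ((b 0).toNat - x) % p - (x + k * p - x) = x + (L - k) * p := by
        rw [hmod, Nat.add_sub_cancel_left]
        have : (L - k) * p + k * p = L * p := by rw [← Nat.add_mul, Nat.sub_add_cancel hkL]
        omega
      rw [e1, hpal k hkL]
    obtain ⟨τ, hD, hinv, hee, hlin, hcen, -⟩ := pal_invol b hp.out.pos hx hc hpal'
    exact wHat_eq_zero_of_invol b τ hD hinv hee hlin hcen hodd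
  · rw [tauW_level₀ b hx hL hL' _ (fun k _ => rfl) hc0, htop]
    exact typeTauW_congr he
  · rw [tauV_level₀ b hx hL hL' _ (fun k _ => rfl) hc0, htop]
    exact typeTauV_congr he
  · exact (CellKit.hat_conj_of_pal b hx hL hL' hb _ (fun k _ => rfl) hpal hc).2

end Deep

/-! ## §4 Live sub-deep classes -/

section Live

variable (b : ℕ → ℤ) (hb : InPolytope b) (hpn : (p : ℤ) ≤ b 0)
  {T : List ℤ} (hT : T.reverse = T) {y : ℕ} (hy : y < p) (hpole : 1 ≤ classPoleCount b p y) (hneg : classExp b p y < 0)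
include hb hpn hT hy hpole hneg

/-- **LIVE PAIR.**  If the type list of the pole class `y` (`E_y < 0`) is a single raise of `T`, or `y` is the odd-centre class with type
list `T`, then `ŵ_y + ŵ_ȳ = τ_W(T)` and `v̂_y + v̂_ȳ = τ_V(T)`. -/
theorem live_pair
    (h4 : isRaise T (classTypeList b p y) = true ∨ (¬ (2 : ℤ) ∣ b 0 ∧ CentreIn b p y ∧ classTypeList b p y = T)) :
    wHat b p y + wHat b p (conjClass b p y) = typeTauW (tTop T) (tList T) ∧
      vHat b p y + vHat b p (conjClass b p y) = typeTauV (tTop T) (tList T) := by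
  have h0 : 0 ≤ b 0 := hb.1.1
  have hp0 : 0 < p := hp.out.pos
  have hyn := le_b0_of_lt b hpn hy
  have hpnN : p ≤ (b 0).toNat := by have := hb.1.1; omega
  obtain ⟨hL, hL'⟩ := level_bounds' (p := p) b hyn
  set M := topLevel b p y with hMdef
  set f : ℕ → ℤ := fun k => netExp b (y + k * p) with hfdef
  have hf : ∀ k ≤ M, netExp b (y + k * p) = f k := fun k _ => rfl
  have hpalT := tList_pal hT
  -- a pole among the levels
  have hfneg : ∃ i ≤ M, f i < 0 := by
    obtain ⟨q, hq⟩ := card_pos.1 (show 0 < ((classSet b p y).filter fun s => netExp b s < 0).card from hpole)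
    have hP : (classSet b p y).filter (fun s => netExp b s < 0) =
        ((range (M + 1)).filter fun k => f k < 0).image fun k => y + k * p := classPoles_level b hy hL hL' f hf
    rw [hP] at hq
    obtain ⟨k, hk, -⟩ := mem_image.1 hq
    obtain ⟨hkr, hkneg⟩ := mem_filter.1 hk
    exact ⟨k, by have := mem_range.1 hkr; omega, hkneg⟩
  -- the conjugate class: levels `0..M`, exponents reversed, same centre status
  obtain ⟨hy', hM2, hM2'⟩ := conj_level b hy hL hL'
  have hfc : ∀ k ≤ M, netExp b (conjClass b p y + k * p) = f (M - k) := fun k hk => netExp_conj_level b hL hL' h0 hk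
  rcases h4 with hr | ⟨hodd, hcen, htl⟩
  · -- Case A: a single raise of `T`
    have hTne : T ≠ [] := by
      rintro rfl
      -- `isRaise [] S` forces `S = [1]`: no pole
      rw [classTypeList_level b hL hL'] at hr
      unfold isRaise at hr
      simp only [List.length_nil, List.range_zero, List.any_nil, Bool.false_or, Bool.or_eq_true, beq_iff_eq,
        List.nil_append, or_self] at hr
      have h1 := congrArg List.length hr
      simp only [List.length_map, List.length_range, List.length_cons, List.length_nil] at h1
      have hM0 : M = 0 := by omega
      obtain ⟨i, hi, hfi⟩ := hfneg
      have hi0 : i = 0 := by omega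
      subst hi0
      rw [hM0] at hr
      have h01 : netExp b y = 1 := by simpa using hr
      have h02 : f 0 = netExp b y := by show netExp b (y + 0 * p) = _; simp
      omega
    rw [← range_map_tList hTne, classTypeList_level b hL hL'] at hr
    -- no odd centre in the class of `y`
    have hc0 : ¬ (¬ (2 : ℤ) ∣ b 0 ∧ CentreIn b p y) := by
      rintro ⟨hodd, hcen⟩
      have hself := (centreIn_iff_conjClass_eq b hpnN hy).1 hcen
      have hfpal : ∀ k ≤ M, f (M - k) = f k := by
        intro k hk; rw [← hfc k hk, hself]
      have h2 := even_of_pal_raise hpalT hfpal hfneg hr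
      exact odd_L_of_centre b hy hL hL' hodd hcen h0 h2
    have hc0' : ¬ (¬ (2 : ℤ) ∣ b 0 ∧ CentreIn b p (conjClass b p y)) :=
      fun h => hc0 ⟨h.1, (centreIn_conj_iff b h0 hyn).1 h.2⟩
    have hw : wHat b p y = typeW M f := wHat_level₀ b hy hL hL' f hf hc0
    have hv : vHat b p y = typeV M f := vHat_level₀ b hy hL hL' f hf hc0
    have hwc : wHat b p (conjClass b p y) = typeW M (fun k => f (M - k)) := wHat_level₀ b hy' hM2 hM2' _ hfc hc0'
    have hvc : vHat b p (conjClass b p y) = typeV M (fun k => f (M - k)) := vHat_level₀ b hy' hM2 hM2' _ hfc hc0'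
    refine ⟨by rw [hw, hwc]; exact typeW_raise_pair hpalT hr, ?_⟩
    rw [hv, hvc, typeV_raise_pair hpalT hr]
    -- the translation term vanishes
    by_cases hML : M = tTop T + 1
    · rw [if_pos hML]
      have hcorr : typeCorr (tTop T) (tList T) = 0 := by
        rcases isRaise_level hr with ⟨k, hk, hML', -⟩ | ⟨-, hfi⟩ | ⟨-, hfi⟩
        · omega
        · -- `y` itself realises `1 :: T`
          rw [hML] at hL hL'
          exact typeCorr_eq_zero_of_consClass b hy hL hL' (tList T) (fun i hi => by rw [← hfi i hi]) hc0 hneg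
        · -- the conjugate class realises `1 :: T`
          rw [hML] at hM2 hM2'
          refine typeCorr_eq_zero_of_consClass b hy' hM2 hM2' (tList T) (fun i hi => ?_) hc0'
            (by rw [classExp_conj b h0 hyn]; exact hneg)
          rw [hfc i (by omega)]
          show netExp b (y + (M - i) * p) = consOne (tList T) i
          rw [hfi (M - i) (by omega), snocOne, consOne]
          by_cases hi0 : i = 0
          · rw [if_pos (by omega), if_pos hi0]
          · rw [if_neg (by omega), if_neg hi0, show M - i = tTop T - (i - 1) by omega, hpalT (i - 1) (by omega)]
      rw [hcorr, add_zero]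
    · rw [if_neg hML, add_zero]
  · -- Case B: the odd-centre class of type `T`
    obtain ⟨htop, he⟩ := spec_of_typeList b hyn htl
    have hself := (centreIn_iff_conjClass_eq b hpnN hy).1 hcen
    have hMT : M = tTop T := by rw [hMdef, ← htop]
    have he' : ∀ k ≤ tTop T, f k = tList T k := fun k hk => he k (by rw [← htop]; exact hk)
    rw [hself, wHat_centre_level b hy hL hL' hodd hcen hb _ hf, vHat_centre_level b hy hL hL' hodd hcen hb _ hf, hMT,
      typeW2_congr he', typeW_congr he', typeV2_congr he', typeV_congr he', typeTauW, typeTauV]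
    constructor <;> ring

end Live

end Summit.KontsevichZagierPeriods.Zeta5Search.SecondOrder

end
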